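import Summits.Ventures.CertifiedManyBodySolver.Rows.CorrWindowCertKernelChainQuotAdjCloser
import Summits.Ventures.CertifiedManyBodySolver.Rows.CorrWindowCertKernelEomLocality
import HarnessLib

/-!
# The ACCEPTED FAMILIES of a hinted (and adjoint-canonicalised) staged kernel replay, BY NAME, and the SEMANTIC RESIDUAL they yield — the interface the
# PAIR paths consume (`…of_residPolys` on the T and WN pinned-pair shapes)

Venture CertifiedManyBodySolver; cell `hubbard-obs` / D-0154 (1)(C) COVERAGE. LANE: hubbard-obs-p2 (STIFFNESS) — these are the objects built INSIDE the proofs of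
`affineOrbitLowerRowN_of_quotChainKernelCertTB` (`Rows/CorrWindowCertKernelChainQuotCloser.lean`, p675452) and `affineOrbitLowerRowN_of_quotAdjChainKernelCertTB`
(`Rows/CorrWindowCertKernelChainQuotAdjCloser.lean`), NAMED so that the pair-path entries of hubbard-cov-la214-unc-2 (T shape, `SquareTTPrimePinnedPairRowT.of_residPolys`
p673208) and hubbard-cov-la214-box-2 (WN shapes, `TPrimePinnedPair{Family,}RowWN.of_residPolys` p673872) consume a hinted chain by name instead of re-inlining the
construction per vertex; typed by hubbard-cov-la214-box-2 g3 under captain hubbard-cov-la214-plan-1 g3 RULING R-g3-7 (hubbard-obs STATUS 2026-08-28T23:03:50Z;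
hubbard-obs-p2 may supersede this file at any time). Nothing of hubbard-obs-p2's is restated as a statement: every proof is a call of its lemmas.

* `allMoves_ok` / `allMovesZ_ok` — every accepted move (plain `stepEQ` / zero-class `stepEQA` edition) is licensed (`D.ok`), by construction of `annotate`
  (hypothesis-free);
* `d4OfCode_mem_of_ok` (from `hokS`), `shiftSet_subset_of_ok` (TABLE CRITERION, from `hokV` + `shiftSet_subset_of_table`), `d_gq_of_moves` (the index letter map
  IS `Γ(incl) ∘ Γ(d4Emb γ v Λ)`, from `d_gq`) — the three geometry facts `…of_residPoly*` consumers need about the accepted family of a move list `L`, with the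
  families written as the lambdas `termOp_symTL_eq` produces (`fun l => gq D (d4OfCode (L.get l).1) (siteOfPair (L.get l).2.1)`, `fun l => (L.get l).2.2`) —
  NO new definitions;
* `evalPoly_quotChain_residTG` (`ChainQOK`, p675151), `evalPoly_quotAdjChain_residTG` (`ChainQAOK` = `stepEQA`, p677450) and `evalPoly_quotAdjChainNear_residTG`
  (`stepEQA` over the eom-local NEAR slices `residTGslicesNear … masks` under the far check `eomFarOK` — the CLOSER OF RECORD's shape) — the last accumulator of a
  chain from the empty start denotes `residTG … TGs.flatten TH D.f EB (fun l => gq D …) (fun l => (L.get l).2.2) CW AV` resp. (with `L := allMovesZ …`)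
  `… CW (AV ++ allAdj D Bkey Ts Hs M)`; the move list enters as `(L) (hL : L = allMoves… …)` so consumers may `set L := …` first: exactly the `hRsem`
  hypothesis of `windowIdentity_of_residPoly` / `affineOrbitLowerRowN_of_residPolyG` (p669665) and of the pair entries.

HONEST FRAMING: Lean plumbing (re-export of in-proof constructions); evaluates nothing, discharges NO node; no number of record / tier / hold / box word / registry
row changes; CONTROL / CALIBRATION context (wording (xx1)); silent on the presence of superconductivity, `T_c`, phase; nothing about any material; no summit statement
is proved here. Zero compute.

References: X. Han, arXiv:2006.06002, §3 [cite: Han2020Bootstrap, §3]; C. Jansson, D. Chaykin, C. Keil, SIAM J. Numer. Anal. 46 (2008) 180, §3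
[cite: JanssonChaykinKeil2008, §3]; J. Wang et al., PRX 14 (2024) 031006, §III [cite: WangEtAl2024, §III].
-/

namespace Summit.Ventures.CertifiedManyBodySolver

namespace CARPolyWindow

open Summit.Ventures.CertifiedQuantumChemistry Summit.Ventures.CertifiedQuantumChemistry.CARPoly
open Literature.MathematicalPhysics.QuantumLattice Literature.MathematicalPhysics.QuantumLattice.HubbardWave0
open Literature.MathematicalPhysics.QuantumManyBody.StateRelaxation
open Literature.Probability.LatticeModels ThermodynamicLimit Filter Topology
open Matrix
open scoped ComplexOrder BigOperators

/-! ## The accepted moves of a hinted chain are licensed; their geometry from the index tables -/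

section QuotFamily

variable {N Nβ : ℕ}

/-- **Every ACCEPTED move is licensed** (`ok`), by construction of `annotate` (plain hinted step `stepEQ`, move list `allMoves`). [folklore] -/
theorem allMoves_ok (D : QuotData N Nβ) (B : ℕ) (Ts : List (Terms (Orb (Fin N)))) (Hs : List (List (QHint Nβ))) :
    ∀ n, ∀ mv ∈ allMoves D B Ts Hs n, D.ok mv.1 mv.2.1 = true := by
  intro n
  induction n with
  | zero => intro mv hmv; rw [allMoves_zero] at hmv; exact absurd hmv List.not_mem_nil
  | succ n ih =>
    intro mv hmv
    rw [allMoves_succ, List.mem_append] at hmv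
    rcases hmv with hmv | hmv
    · exact ih mv hmv
    · rw [movesOf, quotMoves, List.mem_filterMap] at hmv
      obtain ⟨a, ha, hmap⟩ := hmv
      obtain ⟨e, hae, hFe⟩ := Option.map_eq_some_iff.1 hmap
      obtain ⟨hok, -, -⟩ := annotate_ok D B _ _ a ha e hae
      rw [← hFe]
      exact hok

/-- **Every ACCEPTED move of the zero-class edition is licensed** (`stepEQA`, move list `allMovesZ`). [folklore] -/
theorem allMovesZ_ok (D : QuotData N Nβ) (B : ℕ) (Ts : List (Terms (Orb (Fin N)))) (Hs : List (List (QHint Nβ))) :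
    ∀ n, ∀ mv ∈ allMovesZ D B Ts Hs n, D.ok mv.1 mv.2.1 = true := by
  intro n
  induction n with
  | zero => intro mv hmv; rw [allMovesZ_zero] at hmv; exact absurd hmv List.not_mem_nil
  | succ n ih =>
    intro mv hmv
    rw [allMovesZ_succ, List.mem_append] at hmv
    rcases hmv with hmv | hmv
    · exact ih mv hmv
    · rw [movesOfZ, quotMovesZ, List.mem_filterMap] at hmv
      obtain ⟨a, ha, hmap⟩ := hmv
      obtain ⟨e, hae, hFe⟩ := Option.map_eq_some_iff.1 hmap
      obtain ⟨hok, -, -⟩ := annotate_ok D B _ _ a ha e hae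
      rw [← hFe]
      exact hok

/-- The `D₄` codes of a licensed move list lie in `S`. [folklore] -/
theorem d4OfCode_mem_of_ok (D : QuotData N Nβ) {S : Finset (DihedralGroup 4)} (hokS : ∀ γc v, D.ok γc v = true → d4OfCode γc ∈ S)
    (L : List (Fin 8 × (ℤ × ℤ) × Terms (Orb (Fin Nβ)))) (hL : ∀ mv ∈ L, D.ok mv.1 mv.2.1 = true) (l : Fin L.length) :
    d4OfCode (L.get l).1 ∈ S :=
  hokS _ _ (hL _ (List.get_mem L l))

/-- **A licensed move list keeps the inner window inside the outer one** (TABLE CRITERION `shiftSet_subset_of_table`, per move). [folklore] -/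
theorem shiftSet_subset_of_ok {Λ Λ' : Finset (Site 2)} (D : QuotData N Nβ) (hxs : ∀ i, D.xs i ∈ Λ')
    (hcovβ : ∀ x ∈ Λ, ∃ j, D.xsβ j = x)
    (hokV : ∀ γc v, D.ok γc v = true →
      ∀ j : Fin Nβ, D.xs (D.ix (d4Vec (d4OfCode γc) (D.xsβ j) + siteOfPair v)) = d4Vec (d4OfCode γc) (D.xsβ j) + siteOfPair v)
    (L : List (Fin 8 × (ℤ × ℤ) × Terms (Orb (Fin Nβ)))) (hL : ∀ mv ∈ L, D.ok mv.1 mv.2.1 = true) (l : Fin L.length) :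
    d4ShiftSet (d4OfCode (L.get l).1) (siteOfPair (L.get l).2.1) Λ ⊆ Λ' :=
  shiftSet_subset_of_table D hxs hcovβ _ _ (hokV _ _ (hL _ (List.get_mem L l)))

/-- **The index letter maps of a move list ARE `Γ(incl) ∘ Γ(d4Emb γ v Λ)` on letters** (`d_gq`, per move). [cite: Han2020Bootstrap, §3] -/
theorem d_gq_of_moves {Λ Λ' : Finset (Site 2)} (D : QuotData N Nβ) (hxs : ∀ i, D.xs i ∈ Λ')
    (d : Orb (Fin N) → Orb (PolySite Λ')) (hdx : ∀ i σ, d (orb i σ) = orb (PolySite.pt (D.xs i) (hxs i)) σ)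
    (hix : ∀ y ∈ Λ', D.xs (D.ix y) = y)
    (hxsβ : ∀ j, D.xsβ j ∈ Λ) (dΛ : Orb (Fin Nβ) → Orb (PolySite Λ))
    (hdΛ : ∀ j σ, dΛ (orb j σ) = orb (PolySite.pt (D.xsβ j) (hxsβ j)) σ)
    (L : List (Fin 8 × (ℤ × ℤ) × Terms (Orb (Fin Nβ))))
    (hsh : ∀ l : Fin L.length, d4ShiftSet (d4OfCode (L.get l).1) (siteOfPair (L.get l).2.1) Λ ⊆ Λ')
    (l : Fin L.length) (b : Orb (Fin Nβ)) :
    d (gq D (d4OfCode (L.get l).1) (siteOfPair (L.get l).2.1) b) =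
      Orb.embMap (PolySite.incl (hsh l)) (Orb.embMap (PolySite.d4Emb (d4OfCode (L.get l).1) (siteOfPair (L.get l).2.1) Λ) (dΛ b)) := by
  rw [← orb_ofLex_eq b]; exact d_gq D hxs d hdx hix hxsβ dΛ hdΛ _ _ (hsh l) _ _

variable [NeZero N] {ι : Type*} [LinearOrder ι] [Fintype ι]

/-- **THE SEMANTIC RESIDUAL OF A HINTED CHAIN (`stepEQ`, `ChainQOK` p675151)**: the last accumulator of a chain from the empty start over the regrouped sliced
residual WITHOUT symmetry slices (abstract Gram slices `TGs`) denotes the residual WITH the symmetry family of its accepted moves `L := allMoves D Bkey Ts Hs M`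
(families written as the lambdas `termOp_symTL_eq` produces) — the `hRsem` hypothesis of `windowIdentity_of_residPoly` / `affineOrbitLowerRowN_of_residPolyG`
and of every pair-path entry. [cite: Han2020Bootstrap, §3] [cite: JanssonChaykinKeil2008, §3] -/
theorem evalPoly_quotChain_residTG {d : Orb (Fin N) → ι} (hd : Function.Injective d) (D : QuotData N Nβ) (Bkey : ℕ)
    (TX : Terms (Orb (Fin N))) (μ : Fin 2 → ℚ) (ν : ℚ) (o : Fin 2 → Orb (Fin N)) (κhi hi κlo lo : ℚ) (TE : Terms (Orb (Fin N)))
    (TGs : List (Terms (Orb (Fin N)))) (TH : Terms (Orb (Fin N))) (EB : List (Terms (Orb (Fin Nβ))))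
    (CW : Terms (Orb (Fin N))) (AV : List (Terms (Orb (Fin N))))
    (ns : List ℕ) (M : ℕ) (Cs : List SOSDual.EncPoly) (hC0 : Cs.getD 0 [] = []) (Hs : List (List (QHint Nβ)))
    (hchain : ChainQOK D Bkey M Cs
      (groupSlices (residTGslices TX μ ν o κhi hi κlo lo TE TGs TH D.f EB
        (fun l : Fin 0 => l.elim0) (fun l : Fin 0 => l.elim0) CW AV) ns) Hs)
    (L : List (Fin 8 × (ℤ × ℤ) × Terms (Orb (Fin Nβ))))
    (hL : L = allMoves D Bkey (groupSlices (residTGslices TX μ ν o κhi hi κlo lo TE TGs TH D.f EB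
        (fun l : Fin 0 => l.elim0) (fun l : Fin 0 => l.elim0) CW AV) ns) Hs M) :
    evalPoly d (SOSDual.decPoly N (Cs.getD M [])) =
      termOp d (residTG TX μ ν o κhi hi κlo lo TE TGs.flatten TH D.f EB
        (fun l : Fin L.length => gq D (d4OfCode (L.get l).1) (siteOfPair (L.get l).2.1)) (fun l => (L.get l).2.2) CW AV) := by
  subst hL
  rw [evalPoly_chainQ_nil hd hC0 hchain, flatten_groupSlices, flatten_residTGslices, termOp_symTL_eq]
  conv_rhs => rw [termOp_residTG_moves]

/-- **THE SEMANTIC RESIDUAL OF A `stepEQA` CHAIN (`ChainQAOK` p677450: zero-class hinted quotient + automatic adjoint)**: as above with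
`L := allMovesZ …` and the anti-Hermitian family extended by the recorded adjoint generators `allAdj …`. [cite: Han2020Bootstrap, §3] [cite: JanssonChaykinKeil2008, §3] -/
theorem evalPoly_quotAdjChain_residTG {d : Orb (Fin N) → ι} (hd : Function.Injective d) (D : QuotData N Nβ) (Bkey : ℕ)
    (TX : Terms (Orb (Fin N))) (μ : Fin 2 → ℚ) (ν : ℚ) (o : Fin 2 → Orb (Fin N)) (κhi hi κlo lo : ℚ) (TE : Terms (Orb (Fin N)))
    (TGs : List (Terms (Orb (Fin N)))) (TH : Terms (Orb (Fin N))) (EB : List (Terms (Orb (Fin Nβ))))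
    (CW : Terms (Orb (Fin N))) (AV : List (Terms (Orb (Fin N))))
    (ns : List ℕ) (M : ℕ) (Cs : List SOSDual.EncPoly) (hC0 : Cs.getD 0 [] = []) (Hs : List (List (QHint Nβ)))
    (hchain : ChainQAOK D Bkey M Cs
      (groupSlices (residTGslices TX μ ν o κhi hi κlo lo TE TGs TH D.f EB
        (fun l : Fin 0 => l.elim0) (fun l : Fin 0 => l.elim0) CW AV) ns) Hs)
    (L : List (Fin 8 × (ℤ × ℤ) × Terms (Orb (Fin Nβ))))
    (hL : L = allMovesZ D Bkey (groupSlices (residTGslices TX μ ν o κhi hi κlo lo TE TGs TH D.f EB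
        (fun l : Fin 0 => l.elim0) (fun l : Fin 0 => l.elim0) CW AV) ns) Hs M) :
    evalPoly d (SOSDual.decPoly N (Cs.getD M [])) =
      termOp d (residTG TX μ ν o κhi hi κlo lo TE TGs.flatten TH D.f EB
        (fun l : Fin L.length => gq D (d4OfCode (L.get l).1) (siteOfPair (L.get l).2.1)) (fun l => (L.get l).2.2) CW
        (AV ++ allAdj D Bkey (groupSlices (residTGslices TX μ ν o κhi hi κlo lo TE TGs TH D.f EB
          (fun l : Fin 0 => l.elim0) (fun l : Fin 0 => l.elim0) CW AV) ns) Hs M)) := by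
  subst hL
  rw [evalPoly_chainQA_nil hd hC0 hchain, flatten_groupSlices, flatten_residTGslices, termOp_symTL_eq]
  conv_rhs => rw [termOp_residTG_moves_adj]

/-- **THE SEMANTIC RESIDUAL OF A `stepEQA` CHAIN OVER THE EOM-LOCAL (NEAR) SLICES — the closer of record's hypothesis shape** (hubbard-obs-p2's
`affineOrbitLowerRowN_of_quotAdjChainKernelCertTBNear`): slices `residTGslicesNear … masks …` under the far check `eomFarOK TH D.f EB masks = true`
(`termOp_flatten_residTGslicesNear`), `L := allMovesZ …` over the NEAR slice list. [cite: Han2020Bootstrap, §3] [cite: JanssonChaykinKeil2008, §3] -/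
theorem evalPoly_quotAdjChainNear_residTG {d : Orb (Fin N) → ι} (hd : Function.Injective d) (D : QuotData N Nβ) (Bkey : ℕ)
    (TX : Terms (Orb (Fin N))) (μ : Fin 2 → ℚ) (ν : ℚ) (o : Fin 2 → Orb (Fin N)) (κhi hi κlo lo : ℚ) (TE : Terms (Orb (Fin N)))
    (TGs : List (Terms (Orb (Fin N)))) (TH : Terms (Orb (Fin N))) (EB : List (Terms (Orb (Fin Nβ))))
    (masks : List (List Bool)) (hfar : eomFarOK TH D.f EB masks = true)
    (CW : Terms (Orb (Fin N))) (AV : List (Terms (Orb (Fin N))))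
    (ns : List ℕ) (M : ℕ) (Cs : List SOSDual.EncPoly) (hC0 : Cs.getD 0 [] = []) (Hs : List (List (QHint Nβ)))
    (hchain : ChainQAOK D Bkey M Cs
      (groupSlices (residTGslicesNear TX μ ν o κhi hi κlo lo TE TGs TH D.f EB masks
        (fun l : Fin 0 => l.elim0) (fun l : Fin 0 => l.elim0) CW AV) ns) Hs)
    (L : List (Fin 8 × (ℤ × ℤ) × Terms (Orb (Fin Nβ))))
    (hL : L = allMovesZ D Bkey (groupSlices (residTGslicesNear TX μ ν o κhi hi κlo lo TE TGs TH D.f EB masks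
        (fun l : Fin 0 => l.elim0) (fun l : Fin 0 => l.elim0) CW AV) ns) Hs M) :
    evalPoly d (SOSDual.decPoly N (Cs.getD M [])) =
      termOp d (residTG TX μ ν o κhi hi κlo lo TE TGs.flatten TH D.f EB
        (fun l : Fin L.length => gq D (d4OfCode (L.get l).1) (siteOfPair (L.get l).2.1)) (fun l => (L.get l).2.2) CW
        (AV ++ allAdj D Bkey (groupSlices (residTGslicesNear TX μ ν o κhi hi κlo lo TE TGs TH D.f EB masks
          (fun l : Fin 0 => l.elim0) (fun l : Fin 0 => l.elim0) CW AV) ns) Hs M)) := by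
  subst hL
  rw [evalPoly_chainQA_nil hd hC0 hchain, flatten_groupSlices,
    termOp_flatten_residTGslicesNear hd TX μ ν o κhi hi κlo lo TE TGs TH D.f EB masks _ _ CW AV hfar, termOp_symTL_eq]
  conv_rhs => rw [termOp_residTG_moves_adj]

end QuotFamily

end CARPolyWindow

end Summit.Ventures.CertifiedManyBodySolver
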